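import Summits.QuantumFields.BalabanUV.Beta.FP.TorusCompanionLamPacked
import Literature.MathematicalPhysics.QuantumFieldTheory.Balaban1983to89.Beta.StepJetData

/-!
# `BalabanUV.Beta.FP.TorusHSideJetPeriodic` — road «FP» for binder row D1, ROUTE T (β1), SPEC-48 §E (E3):
# **THE END WRAPPER's PINNED FIRST-ORDER H-SIDE JET `H₁f v` IS ONE PERIODISED LATTICE KERNEL `perF T (dper T 𝒱)` ON THE FINEST TORUS —
# the W term and EVERY Λ-storey (the top one = co-depth `0`) as periodised cores, summed under their letters; `𝒱` DISPLAYED**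

WHY.  The END wrapper `StepRecursionFeedNestedNamedB.d1Tel_JcComp_ctr_named` (p405971 ✓) pins (`hH₁f`)
`H₁f v = (−2c) • Σ_b hb b • (perF T (dper T (wilsonA b)))|ff + w • Σ_ā hb ā • (perF T (dper T (SLam N cf 𝒽 ā)))|ff + compSumSym Lc (onTowerFamily Lc M F) M lev rs n`
on the finest torus `T := towerTorus Lc M n`, while its N-binding `hHN₁` reads the (X-conjugated) jet as ONE periodised lattice kernel `(perF T (dper T (VN …)))|ff`.
g36 packed the companion sum (`TorusCompanionLamPacked.compSumSym_lam_eq_perF_dper`, p409603 ✓) as `perF T (dper T (Σ_{j<n} 𝒦_j))`, `𝒦_j` = the sandwich of the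
storey-`j` Λ-core by an2's composite linear legs `compLinKer ℓ Lc (n − j)`.  THIS FILE closes (E3): the TOP Λ term is the co-depth-`0` storey of the SAME display
(`compLinKer ℓ Lc 0` = the bond delta, §3), the W term is the periodised W-core (`TorusCompanionCorePeriodic.perF_dper_core_of_biLoc` with the lit letter
`StepJetData.locStencil_wilsonA`, §4), and `perF ∘ dper` is additive under the two pointwise summability letters (§1) — so **`H₁f v = perF T (dper T 𝒱)`** for the
DISPLAYED lattice kernel `𝒱 x y a b = (−2c) · Σ_b hb n b · wilsonA d b.2 b.1 x y (inl a) (inl b) + Σ_{j ≤ n} 𝒦_j x y a b` (§6 `H1f_eq_perF_dper`), with the two letters of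
`𝒱` (§6) and of every storey kernel `𝒦_j`, `j ≤ n` (§5 — g36 had them only inside a proof) exported for the (E4) match.

WHAT ([folklore] `tsum` bookkeeping BY NAME over g36's seven files; no `def`, no `def … : Prop`, nothing cited, 0 sorry):
§1 `dper_apply_of_eq_add`, `summable_diag_of_eq_add`, `summable_right_of_eq_add`, `perF_dper_of_eq_add` (additivity of `dper` and `perF ∘ dper` under the letters,
for a kernel DISPLAYED as a sum); §2 the wrapper's data generically, `brick_rebase`, `storey_display`; §3 `sandwich_delta_eval`, `storey_top_eq_core`; §4
`perF_dper_wCore` (the W term alone), the W letters, `H1fKernel_eq`; §5 the Λ-storeys' letters `summable_{brick,lamCore,storey,storeySum}_{diag,right}`; §6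
**`H1f_eq_perF_dper`**, `summable_H1fKernel_diag ∕ _right`.  WRAPPER DICTIONARY (instantiate, nothing to prove): `d := 3`, `n := n+1`, `M := fine Lc (Mc B)`,
`lev i := n+1−i`, `rs _ := ctrOff 4 Lc`, `w := w n`, `c := c n`, `hb k := hb n B k v`, `cf := cf n B`, `𝒽 μ y := symHessFFAt (toSite (ctrOff 4 Lc)) Lc μ y`.
WHAT THIS IS NOT: not the identification of `𝒱` with the ff-block of an2's `VN (n+1) μ y` at `v := dv n B (μ, y)` ((E4) ∕ (C1), the row's words: F6a′
`compVHKer_unroll`, F6a″ `liftUp_eq_sum_compLinKer`, F6a‴ `tsum_mul_compVHKer_eq`, PART 8 `mul_sum_mul_SLam_eq`, the table words); not the X-conjugation of `hH'₁f`;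
not a discharge of `LocStencil (SLam N (cf j) 𝒽)` (an2's `locStencil_SLam` ⟸ PART 9 `abs_pullback_le` + an1's `vertexFamily_symHessFFAt`); no row of the END wrapper
discharged; no estimate; nothing of Bałaban's asserted, valued or discharged; 0∕4 row-D1 binders (hW, hR, D1Tel, D1Rep); ROOT M‴ p325680 untouched; NOT (C1),
NOT (L2′), NOT (T-ID), NOT SDF, NOT D1, NOT BetaPertH, NOT continuum, NOT Clay.

HONEST DEPENDENCY (page 1, mandatory): continuum YM on T⁴ ⇐ BetaPertH ∧ nine spine estimates (0/9 proved); BetaPertH ⇐ (D1) ∧ (D4) ∧ CAP+tail;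
G-an2-4 gates asym, D1 and NE2/3/4.  HONEST FRAMING (cell contract, verbatim): «discharging `BetaPertH` makes Bałaban's UV stability UNCONDITIONAL —
a real constructive-QFT result; it is NOT the continuum limit and NOT the Clay problem.»  ABSOLUTE RULE (cell charter, verbatim): «No internally-minted
statement may enter as a cited fact. Every hypothesis is either kernel-proved in this package or a verbatim quotation of a PUBLISHED theorem with page
reference. The manuscript(s) under audit are NOT citable for their own disputed steps — they are the thing under adjudication; programme-internal
(2001/route/tribunal) claims are never citable.»  Road «FP» OWNER, b2b-balaban-beta-d1-p3 gen 37, 2026-08-26.  No existing file touched.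
-/

noncomputable section

open scoped BigOperators

namespace Summit.QuantumFields.BalabanUV.Beta.FP.TorusHSideJetPeriodic

open Finset Matrix
open Literature.MathematicalPhysics.QuantumFieldTheory.Balaban1983to89 Literature.MathematicalPhysics.QuantumFieldTheory.Balaban1983to89.Beta
open B4TorusKernel.MultiPeriod (translate)  open B6Lemma24Torus (pbox)  open AffineAveraging (Site)  open AveragingHessianKernels (Bond)
open AveragingContoursRooted (ctr)  open ExpKernelCalculus (MKer BiLoc)  open OneStepResolventKernel (Fib LocStencil)  open InterLevelTransport (SLam)
open StepJetData (wilsonA wBound wBound_nonneg locStencil_wilsonA)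
open Summit.QuantumFields.BalabanUV.Beta.SymAveragingHessianCounts (symLinKerAt)  open Summit.QuantumFields.BalabanUV.Beta.BorderedHessian (stepScale)
open Summit.QuantumFields.BalabanUV.Beta.CompositeVertexKernelRec (compLinKer compLinKer_zero)
open Summit.QuantumFields.BalabanUV.Beta.FP.KernelPeriodisationFib (Idx perF perF_apply perZ perZ_apply)
open Summit.QuantumFields.BalabanUV.Beta.FP.KernelPeriodisationFibLoc (dper dper_apply)
open Summit.QuantumFields.BalabanUV.Beta.FP.TorusCompositeObjects (towerTorus)  open Summit.QuantumFields.BalabanUV.Beta.FP.TorusCompositeObjectsG (compRowsSym)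
open Summit.QuantumFields.BalabanUV.Beta.FP.TorusCompositeCompanionSumG (compSumSym)  open Summit.QuantumFields.BalabanUV.Beta.FP.TorusCompositeCompanionFamilyG (onTowerFamily)
open Summit.QuantumFields.BalabanUV.Beta.FP.TorusCompositeRowsSymKernel (rowsLeg_translate exists_rowsLeg_window)
open Summit.QuantumFields.BalabanUV.Beta.FP.TorusCompanionSumPeriodic (perF_dper_finset_sum)
open Summit.QuantumFields.BalabanUV.Beta.FP.TorusCompanionCorePeriodic (perF_dper_core_of_biLoc summable_core_diag summable_core_right summable_ff_diag_of_biLoc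
  summable_ff_right_of_biLoc)
open Summit.QuantumFields.BalabanUV.Beta.FP.TorusTwoScaleSandwichLetters (summable_sandwich_diag_of_tsum summable_dper_sandwich_right_of_tsum)
open Summit.QuantumFields.BalabanUV.Beta.FP.TorusCompanionLamPacked (compSumSym_lam_eq_perF_dper towerTorus_towerTorus)

variable {d : ℕ}

/-! ## §1 Additivity of `dper` and of `perF ∘ dper` under the letters, for a kernel displayed as a sum -/

section Additivity

variable (T : Fin (d + 1) → ℕ) {F : Type*} {V A B : MKer (d + 1) F} (hV : V = A + B)
  (hA : ∀ (x y : Fin (d + 1) → ℤ) (a b : F), Summable fun m₀ : Fin (d + 1) → ℤ => A (translate T x m₀) (translate T y m₀) a b)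
  (hB : ∀ (x y : Fin (d + 1) → ℤ) (a b : F), Summable fun m₀ : Fin (d + 1) → ℤ => B (translate T x m₀) (translate T y m₀) a b)
include hV hA hB

/-- [folklore] **`dper_apply_of_eq_add`**: the diagonal periodisation of `V = A + B` is entrywise the sum, under the diagonal letters of `A` and `B`. -/
theorem dper_apply_of_eq_add (x y : Fin (d + 1) → ℤ) (a b : F) : dper T V x y a b = dper T A x y a b + dper T B x y a b := by
  subst hV
  simp only [dper_apply, Pi.add_apply]
  exact (hA x y a b).tsum_add (hB x y a b)

/-- [folklore] the diagonal letter of `V = A + B`. -/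
theorem summable_diag_of_eq_add (x y : Fin (d + 1) → ℤ) (a b : F) :
    Summable fun m₀ : Fin (d + 1) → ℤ => V (translate T x m₀) (translate T y m₀) a b := by
  subst hV
  simp only [Pi.add_apply]
  exact (hA x y a b).add (hB x y a b)

variable (hAp : ∀ (x y : Fin (d + 1) → ℤ) (a b : F), Summable fun m : Fin (d + 1) → ℤ => dper T A x (translate T y m) a b)
  (hBp : ∀ (x y : Fin (d + 1) → ℤ) (a b : F), Summable fun m : Fin (d + 1) → ℤ => dper T B x (translate T y m) a b)
include hAp hBp

/-- [folklore] the second-argument letter of `V = A + B`. -/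
theorem summable_right_of_eq_add (x y : Fin (d + 1) → ℤ) (a b : F) :
    Summable fun m : Fin (d + 1) → ℤ => dper T V x (translate T y m) a b := by
  simp_rw [dper_apply_of_eq_add T hV hA hB]
  exact (hAp x y a b).add (hBp x y a b)

/-- [folklore] **`perF_dper_of_eq_add` — `perF T (dper T V) = perF T (dper T A) + perF T (dper T B)` for `V = A + B`** under the two letters of each summand. -/
theorem perF_dper_of_eq_add : perF T (dper T V) = perF T (dper T A) + perF T (dper T B) := by
  ext p q
  simp only [Matrix.add_apply, perF_apply, perZ_apply, dper_apply_of_eq_add T hV hA hB]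
  exact (hAp _ _ p.2 q.2).tsum_add (hBp _ _ p.2 q.2)

end Additivity

/-! ## §2 The data of the wrapper's pin `hH₁f`, generically; the displays re-based per storey -/

section Storeys

variable (Lc : ℕ) [NeZero Lc] (N n : ℕ) (M : Fin (d + 1) → ℕ) [∀ μ, NeZero (M μ)] (lev : ℕ → ℕ)
  (ℓ : ℕ → Fin (d + 1) → Site (d + 1) → Bond (d + 1) → ℝ)
  (𝒽 : Fin (d + 1) → Site (d + 1) → MKer (d + 1) (Fib d))
  (cf : ℕ → Fin (d + 1) → Site (d + 1) → Fin (d + 1) → Site (d + 1) → ℝ) (w : ℕ → ℝ)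
  (hb : (k : ℕ) → (↥(pbox (towerTorus Lc M k)) × Fin (d + 1) → ℝ))

omit [NeZero Lc] in
/-- [folklore] the ONE brick list re-based at storey `j` (co-depth `c`, `j + c = n`): the same display with `lev ∘ (· + j)` (`omega`). -/
theorem brick_rebase
    (hℓ : ∀ i < n, ∀ (μ : Fin (d + 1)) (y : Site (d + 1)) (g : Bond (d + 1)),
      ℓ i μ y g = stepScale d Lc (lev (n - i)) * ((Lc : ℝ) ^ (d + 1) * symLinKerAt (ctr (d + 1) Lc) Lc μ y g))
    (j c : ℕ) (hjc : j + c = n) : ∀ i < c, ∀ (μ : Fin (d + 1)) (y : Site (d + 1)) (g : Bond (d + 1)),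
    ℓ i μ y g = stepScale d Lc ((fun i => lev (i + j)) (c - i)) * ((Lc : ℝ) ^ (d + 1) * symLinKerAt (ctr (d + 1) Lc) Lc μ y g) :=
  fun i hi μ y g => by rw [hℓ i (by omega), show n - i = c - i + j by omega]

omit [NeZero Lc] [∀ μ, NeZero (M μ)] in
/-- [folklore] the storey display at co-depth `c` (`n − j = c`), the core written as the engine's lambda. -/
theorem storey_display {𝒦 : ℕ → MKer (d + 1) (Fin (d + 1))}
    (h𝒦 : ∀ j ≤ n, ∀ (β β' : Site (d + 1)) (b b' : Fin (d + 1)), 𝒦 j β β' b b'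
      = ∑ a : Fin (d + 1), ∑ a' : Fin (d + 1), ∑' γ : Site (d + 1), ∑' γ' : Site (d + 1),
          compLinKer ℓ Lc (n - j) (b, β) (a, γ)
            * (w j * ∑ ā : ↥(pbox (towerTorus Lc M j)) × Fin (d + 1),
                hb j ā * SLam N (cf j) 𝒽 ā.2 (ā.1 : Site (d + 1)) γ γ' (Sum.inl a) (Sum.inl a'))
            * compLinKer ℓ Lc (n - j) (b', β') (a', γ'))
    (j c : ℕ) (hjc : j + c = n) (β β' : Site (d + 1)) (b b' : Fin (d + 1)) : 𝒦 j β β' b b'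
    = ∑ a : Fin (d + 1), ∑ a' : Fin (d + 1), ∑' γ : Site (d + 1), ∑' γ' : Site (d + 1),
        compLinKer ℓ Lc c (b, β) (a, γ)
          * (fun x y (a b : Fin (d + 1)) => w j * ∑ ā : ↥(pbox (towerTorus Lc M j)) × Fin (d + 1),
              hb j ā * SLam N (cf j) 𝒽 ā.2 (ā.1 : Site (d + 1)) x y (Sum.inl a) (Sum.inl b)) γ γ' a a'
          * compLinKer ℓ Lc c (b', β') (a', γ') := by
  rw [h𝒦 j (by omega) β β' b b', show n - j = c by omega]

/-! ## §3 The top storey: at co-depth `0` the displayed sandwich is the core -/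

omit [NeZero Lc] in
/-- [folklore] **`sandwich_delta_eval`**: `compLinKer ℓ Lc 0` is the bond delta (`compLinKer_zero`), so the co-depth-`0` sandwich of ANY core `G` evaluates to `G` at
the outer bonds (one `tsum_eq_single` per leg, one `Finset.sum_eq_single` per fibre). -/
theorem sandwich_delta_eval (G : Fin (d + 1) → Site (d + 1) → Fin (d + 1) → Site (d + 1) → ℝ) (β β' : Site (d + 1)) (b b' : Fin (d + 1)) :
    ∑ a : Fin (d + 1), ∑ a' : Fin (d + 1), ∑' γ : Site (d + 1), ∑' γ' : Site (d + 1),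
        compLinKer ℓ Lc 0 (b, β) (a, γ) * G a γ a' γ' * compLinKer ℓ Lc 0 (b', β') (a', γ')
      = G b β b' β' := by
  have hin : ∀ (a : Fin (d + 1)) (γ : Site (d + 1)) (a' : Fin (d + 1)),
      ∑' γ' : Site (d + 1), compLinKer ℓ Lc 0 (b, β) (a, γ) * G a γ a' γ' * compLinKer ℓ Lc 0 (b', β') (a', γ')
        = compLinKer ℓ Lc 0 (b, β) (a, γ) * G a γ a' β' * compLinKer ℓ Lc 0 (b', β') (a', β') := fun a γ a' =>
    tsum_eq_single β' fun γ' hγ' => by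
      rw [compLinKer_zero (b', β') (a', γ'), if_neg (fun h => hγ' (Prod.mk.inj h).2), mul_zero]
  have hout : ∀ a a' : Fin (d + 1),
      ∑' γ : Site (d + 1), compLinKer ℓ Lc 0 (b, β) (a, γ) * G a γ a' β' * compLinKer ℓ Lc 0 (b', β') (a', β')
        = compLinKer ℓ Lc 0 (b, β) (a, β) * G a β a' β' * compLinKer ℓ Lc 0 (b', β') (a', β') := fun a a' =>
    tsum_eq_single β fun γ hγ => by
      rw [compLinKer_zero (b, β) (a, γ), if_neg (fun h => hγ (Prod.mk.inj h).2), zero_mul, zero_mul]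
  simp_rw [hin, hout]
  rw [Finset.sum_eq_single b (fun a _ ha => Finset.sum_eq_zero fun a' _ => by
        rw [compLinKer_zero (b, β) (a, β), if_neg (fun h => ha (Prod.mk.inj h).1), zero_mul, zero_mul])
      (fun h => absurd (Finset.mem_univ b) h),
    Finset.sum_eq_single b' (fun a' _ ha' => by
        rw [compLinKer_zero (b', β') (a', β'), if_neg (fun h => ha' (Prod.mk.inj h).1), mul_zero])
      (fun h => absurd (Finset.mem_univ b') h),
    compLinKer_zero (b, β) (b, β), compLinKer_zero (b', β') (b', β'), if_pos rfl, if_pos rfl, one_mul, mul_one]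

omit [NeZero Lc] [∀ μ, NeZero (M μ)] in
/-- [folklore] **`storey_top_eq_core`**: the storey-`n` kernel of the display IS the top Λ-core `fun x y a b => w n * Σ_ā hb n ā * SLam N (cf n) 𝒽 ā.2 ā.1 x y (inl a) (inl b)`
(the engine's core lambda at storey `n`; `sandwich_delta_eval`). -/
theorem storey_top_eq_core {𝒦 : ℕ → MKer (d + 1) (Fin (d + 1))}
    (h𝒦 : ∀ j ≤ n, ∀ (β β' : Site (d + 1)) (b b' : Fin (d + 1)), 𝒦 j β β' b b'
      = ∑ a : Fin (d + 1), ∑ a' : Fin (d + 1), ∑' γ : Site (d + 1), ∑' γ' : Site (d + 1),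
          compLinKer ℓ Lc (n - j) (b, β) (a, γ)
            * (w j * ∑ ā : ↥(pbox (towerTorus Lc M j)) × Fin (d + 1),
                hb j ā * SLam N (cf j) 𝒽 ā.2 (ā.1 : Site (d + 1)) γ γ' (Sum.inl a) (Sum.inl a'))
            * compLinKer ℓ Lc (n - j) (b', β') (a', γ')) :
    𝒦 n = fun x y (a b : Fin (d + 1)) => w n * ∑ ā : ↥(pbox (towerTorus Lc M n)) × Fin (d + 1),
      hb n ā * SLam N (cf n) 𝒽 ā.2 (ā.1 : Site (d + 1)) x y (Sum.inl a) (Sum.inl b) := by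
  funext β β' b b'
  rw [h𝒦 n le_rfl β β' b b', Nat.sub_self]
  exact sandwich_delta_eval Lc ℓ (fun a γ a' γ' => w n * ∑ ā : ↥(pbox (towerTorus Lc M n)) × Fin (d + 1),
    hb n ā * SLam N (cf n) 𝒽 ā.2 (ā.1 : Site (d + 1)) γ γ' (Sum.inl a) (Sum.inl a')) β β' b b'

/-! ## §4 The W term: a periodised core by the lit letter `locStencil_wilsonA` -/

/-- [folklore] **THE W TERM IS A PERIODISED CORE**: `(−2c) • Σ_b hb n b • (perF T (dper T (wilsonA d b.2 b.1)))|ff = perF T (dper T 𝒲)` for the displayed W-core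
`𝒲 x y a b := (−2c) · Σ_b hb n b · wilsonA d b.2 b.1 x y (inl a) (inl b)` — `perF_dper_core_of_biLoc` with the lit letter `StepJetData.locStencil_wilsonA` (rate `1`). -/
theorem perF_dper_wCore (c : ℝ) :
    (-2 * c) • ∑ b₀ : ↥(pbox (towerTorus Lc M n)) × Fin (d + 1), hb n b₀ •
        (perF (towerTorus Lc M n) (dper (towerTorus Lc M n) (wilsonA d b₀.2 (b₀.1 : Site (d + 1))))).submatrix
          (fun p : ↥(pbox (towerTorus Lc M n)) × Fin (d + 1) => ((p.1, Sum.inl p.2) : Idx (towerTorus Lc M n) (Fib d)))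
          (fun p : ↥(pbox (towerTorus Lc M n)) × Fin (d + 1) => ((p.1, Sum.inl p.2) : Idx (towerTorus Lc M n) (Fib d)))
      = perF (towerTorus Lc M n) (dper (towerTorus Lc M n) (fun x y (a b : Fin (d + 1)) =>
          (-2 * c) * ∑ b₀ : ↥(pbox (towerTorus Lc M n)) × Fin (d + 1), hb n b₀ * wilsonA d b₀.2 (b₀.1 : Site (d + 1)) x y (Sum.inl a) (Sum.inl b))) :=
  (perF_dper_core_of_biLoc (towerTorus Lc M n) (fun b₀ : ↥(pbox (towerTorus Lc M n)) × Fin (d + 1) => wilsonA d b₀.2 (b₀.1 : Site (d + 1)))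
    (p := fun b₀ => (b₀.1 : Site (d + 1))) (q := fun b₀ => (b₀.1 : Site (d + 1))) (C := fun _ => wBound d * Real.exp (4 * 1)) (δ := 1) (-2 * c) (hb n)
    (fun b₀ => locStencil_wilsonA (d := d) zero_le_one b₀.2 (b₀.1 : Site (d + 1))) (fun _ => mul_nonneg (wBound_nonneg d) (Real.exp_pos _).le) one_pos).symm

/-- [folklore] the W-core's diagonal letter on the finest torus. -/
theorem summable_wCore_diag (c : ℝ) (x y : Site (d + 1)) (a b : Fin (d + 1)) :
    Summable fun m₀ : Site (d + 1) => (fun x y (a b : Fin (d + 1)) =>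
        (-2 * c) * ∑ b₀ : ↥(pbox (towerTorus Lc M n)) × Fin (d + 1), hb n b₀ * wilsonA d b₀.2 (b₀.1 : Site (d + 1)) x y (Sum.inl a) (Sum.inl b))
      (translate (towerTorus Lc M n) x m₀) (translate (towerTorus Lc M n) y m₀) a b :=
  summable_core_diag (towerTorus Lc M n) (-2 * c) (hb n) (fun b₀ : ↥(pbox (towerTorus Lc M n)) × Fin (d + 1) => wilsonA d b₀.2 (b₀.1 : Site (d + 1)))
    (summable_ff_diag_of_biLoc (towerTorus Lc M n) (fun b₀ : ↥(pbox (towerTorus Lc M n)) × Fin (d + 1) => wilsonA d b₀.2 (b₀.1 : Site (d + 1)))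
      (p := fun b₀ => (b₀.1 : Site (d + 1))) (q := fun b₀ => (b₀.1 : Site (d + 1))) (C := fun _ => wBound d * Real.exp (4 * 1)) (δ := 1)
      (fun b₀ => locStencil_wilsonA (d := d) zero_le_one b₀.2 (b₀.1 : Site (d + 1))) (fun _ => mul_nonneg (wBound_nonneg d) (Real.exp_pos _).le) one_pos) x y a b

/-- [folklore] the W-core's second-argument letter on the finest torus. -/
theorem summable_wCore_right (c : ℝ) (x y : Site (d + 1)) (a b : Fin (d + 1)) :
    Summable fun m : Site (d + 1) => dper (towerTorus Lc M n) (fun x y (a b : Fin (d + 1)) =>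
        (-2 * c) * ∑ b₀ : ↥(pbox (towerTorus Lc M n)) × Fin (d + 1), hb n b₀ * wilsonA d b₀.2 (b₀.1 : Site (d + 1)) x y (Sum.inl a) (Sum.inl b))
      x (translate (towerTorus Lc M n) y m) a b :=
  summable_core_right (towerTorus Lc M n) (-2 * c) (hb n) (fun b₀ : ↥(pbox (towerTorus Lc M n)) × Fin (d + 1) => wilsonA d b₀.2 (b₀.1 : Site (d + 1)))
    (summable_ff_diag_of_biLoc (towerTorus Lc M n) (fun b₀ : ↥(pbox (towerTorus Lc M n)) × Fin (d + 1) => wilsonA d b₀.2 (b₀.1 : Site (d + 1)))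
      (p := fun b₀ => (b₀.1 : Site (d + 1))) (q := fun b₀ => (b₀.1 : Site (d + 1))) (C := fun _ => wBound d * Real.exp (4 * 1)) (δ := 1)
      (fun b₀ => locStencil_wilsonA (d := d) zero_le_one b₀.2 (b₀.1 : Site (d + 1))) (fun _ => mul_nonneg (wBound_nonneg d) (Real.exp_pos _).le) one_pos)
    (summable_ff_right_of_biLoc (towerTorus Lc M n) (fun b₀ : ↥(pbox (towerTorus Lc M n)) × Fin (d + 1) => wilsonA d b₀.2 (b₀.1 : Site (d + 1)))
      (p := fun b₀ => (b₀.1 : Site (d + 1))) (q := fun b₀ => (b₀.1 : Site (d + 1))) (C := fun _ => wBound d * Real.exp (4 * 1)) (δ := 1)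
      (fun b₀ => locStencil_wilsonA (d := d) zero_le_one b₀.2 (b₀.1 : Site (d + 1))) (fun _ => mul_nonneg (wBound_nonneg d) (Real.exp_pos _).le) one_pos) x y a b

omit [NeZero Lc] [∀ μ, NeZero (M μ)] in
/-- [folklore] the display of `𝒱` (W-core + the `n+1` storey kernels) as a sum of two lattice kernels. -/
theorem H1fKernel_eq {𝒦 : ℕ → MKer (d + 1) (Fin (d + 1))} {𝒱 : MKer (d + 1) (Fin (d + 1))} (c : ℝ)
    (h𝒱 : ∀ (x y : Site (d + 1)) (a b : Fin (d + 1)), 𝒱 x y a b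
      = (-2 * c) * (∑ b₀ : ↥(pbox (towerTorus Lc M n)) × Fin (d + 1), hb n b₀ * wilsonA d b₀.2 (b₀.1 : Site (d + 1)) x y (Sum.inl a) (Sum.inl b))
        + ∑ j ∈ Finset.range (n + 1), 𝒦 j x y a b) :
    𝒱 = (fun x y (a b : Fin (d + 1)) =>
        (-2 * c) * ∑ b₀ : ↥(pbox (towerTorus Lc M n)) × Fin (d + 1), hb n b₀ * wilsonA d b₀.2 (b₀.1 : Site (d + 1)) x y (Sum.inl a) (Sum.inl b))
      + ∑ j ∈ Finset.range (n + 1), 𝒦 j := by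
  funext x y a b
  rw [h𝒱 x y a b]
  simp only [Pi.add_apply, Finset.sum_apply]

/-! ## §5 The Λ-storeys' letters on the finest torus, every storey `j ≤ n` -/

variable {Cs : ℕ → ℝ} {δ : ℝ} (hLS : ∀ j, LocStencil (SLam N (cf j) 𝒽) (Cs j) δ) (hCs : ∀ j, 0 ≤ Cs j) (hδ : 0 < δ)
include hLS hCs hδ

/-- [folklore] the Λ-bricks' diagonal letter at the `ff` fibres on the storey torus (`BiLoc` at the bond, `TorusCompanionCorePeriodic.summable_ff_diag_of_biLoc`). -/
theorem summable_brick_diag (j : ℕ) (ā : ↥(pbox (towerTorus Lc M j)) × Fin (d + 1)) (x y : Site (d + 1)) (a b : Fin (d + 1)) :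
    Summable fun m₀ : Site (d + 1) => SLam N (cf j) 𝒽 ā.2 (ā.1 : Site (d + 1)) (translate (towerTorus Lc M j) x m₀) (translate (towerTorus Lc M j) y m₀)
      (Sum.inl a) (Sum.inl b) :=
  summable_ff_diag_of_biLoc (towerTorus Lc M j) (fun ā : ↥(pbox (towerTorus Lc M j)) × Fin (d + 1) => SLam N (cf j) 𝒽 ā.2 (ā.1 : Site (d + 1)))
    (p := fun ā => (ā.1 : Site (d + 1))) (q := fun ā => (ā.1 : Site (d + 1))) (C := fun _ => Cs j) (δ := δ) (fun ā => hLS j ā.2 (ā.1 : Site (d + 1))) (fun _ => hCs j) hδ ā x y a b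

/-- [folklore] the Λ-bricks' second-argument letter at the `ff` fibres on the storey torus (`summable_ff_right_of_biLoc`). -/
theorem summable_brick_right (j : ℕ) (ā : ↥(pbox (towerTorus Lc M j)) × Fin (d + 1)) (x y : Site (d + 1)) (a b : Fin (d + 1)) :
    Summable fun m : Site (d + 1) => dper (towerTorus Lc M j) (SLam N (cf j) 𝒽 ā.2 (ā.1 : Site (d + 1))) x (translate (towerTorus Lc M j) y m)
      (Sum.inl a) (Sum.inl b) :=
  summable_ff_right_of_biLoc (towerTorus Lc M j) (fun ā : ↥(pbox (towerTorus Lc M j)) × Fin (d + 1) => SLam N (cf j) 𝒽 ā.2 (ā.1 : Site (d + 1)))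
    (p := fun ā => (ā.1 : Site (d + 1))) (q := fun ā => (ā.1 : Site (d + 1))) (C := fun _ => Cs j) (δ := δ) (fun ā => hLS j ā.2 (ā.1 : Site (d + 1))) (fun _ => hCs j) hδ ā x y a b

/-- [folklore] **the storey-`j` Λ-core's diagonal letter** (`hGd` of the engine): `fun x y a b => w j * Σ_ā hb j ā * SLam N (cf j) 𝒽 ā.2 ā.1 x y (inl a) (inl b)`. -/
theorem summable_lamCore_diag (j : ℕ) (x y : Site (d + 1)) (a b : Fin (d + 1)) :
    Summable fun m₀ : Site (d + 1) =>
      (fun x y (a b : Fin (d + 1)) => w j * ∑ ā : ↥(pbox (towerTorus Lc M j)) × Fin (d + 1),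
          hb j ā * SLam N (cf j) 𝒽 ā.2 (ā.1 : Site (d + 1)) x y (Sum.inl a) (Sum.inl b))
        (translate (towerTorus Lc M j) x m₀) (translate (towerTorus Lc M j) y m₀) a b :=
  summable_core_diag (towerTorus Lc M j) (w j) (hb j) (fun ā : ↥(pbox (towerTorus Lc M j)) × Fin (d + 1) => SLam N (cf j) 𝒽 ā.2 (ā.1 : Site (d + 1)))
    (summable_brick_diag Lc N M 𝒽 cf hLS hCs hδ j) x y a b

/-- [folklore] **the storey-`j` Λ-core's second-argument letter** (`hGp` of the engine). -/
theorem summable_lamCore_right (j : ℕ) (x y : Site (d + 1)) (a b : Fin (d + 1)) :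
    Summable fun m : Site (d + 1) =>
      dper (towerTorus Lc M j) (fun x y (a b : Fin (d + 1)) => w j * ∑ ā : ↥(pbox (towerTorus Lc M j)) × Fin (d + 1),
          hb j ā * SLam N (cf j) 𝒽 ā.2 (ā.1 : Site (d + 1)) x y (Sum.inl a) (Sum.inl b)) x (translate (towerTorus Lc M j) y m) a b :=
  summable_core_right (towerTorus Lc M j) (w j) (hb j) (fun ā : ↥(pbox (towerTorus Lc M j)) × Fin (d + 1) => SLam N (cf j) 𝒽 ā.2 (ā.1 : Site (d + 1)))
    (summable_brick_diag Lc N M 𝒽 cf hLS hCs hδ j) (summable_brick_right Lc N M 𝒽 cf hLS hCs hδ j) x y a b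

variable (hℓ : ∀ i < n, ∀ (μ : Fin (d + 1)) (y : Site (d + 1)) (g : Bond (d + 1)),
    ℓ i μ y g = stepScale d Lc (lev (n - i)) * ((Lc : ℝ) ^ (d + 1) * symLinKerAt (ctr (d + 1) Lc) Lc μ y g))
  {𝒦 : ℕ → MKer (d + 1) (Fin (d + 1))}
  (h𝒦 : ∀ j ≤ n, ∀ (β β' : Site (d + 1)) (b b' : Fin (d + 1)), 𝒦 j β β' b b'
    = ∑ a : Fin (d + 1), ∑ a' : Fin (d + 1), ∑' γ : Site (d + 1), ∑' γ' : Site (d + 1),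
        compLinKer ℓ Lc (n - j) (b, β) (a, γ)
          * (w j * ∑ ā : ↥(pbox (towerTorus Lc M j)) × Fin (d + 1),
              hb j ā * SLam N (cf j) 𝒽 ā.2 (ā.1 : Site (d + 1)) γ γ' (Sum.inl a) (Sum.inl a'))
          * compLinKer ℓ Lc (n - j) (b', β') (a', γ'))
include hℓ h𝒦

/-- [folklore] **THE STOREY KERNEL's DIAGONAL LETTER ON THE FINEST TORUS**, every storey `j ≤ n` (the sandwich letter `summable_sandwich_diag_of_tsum` at
`Tc := towerTorus Lc M j`, `Tf := towerTorus Lc M n`, windows `exists_rowsLeg_window`, equivariance `rowsLeg_translate`, core letter `summable_lamCore_diag`). -/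
theorem summable_storey_diag (j : ℕ) (hj : j ≤ n) (x y : Site (d + 1)) (a b : Fin (d + 1)) :
    Summable fun m₀ : Site (d + 1) => 𝒦 j (translate (towerTorus Lc M n) x m₀) (translate (towerTorus Lc M n) y m₀) a b := by
  obtain ⟨S, hS⟩ := exists_rowsLeg_window Lc (n - j) ℓ
  have h := summable_sandwich_diag_of_tsum (towerTorus Lc M j) (towerTorus Lc (towerTorus Lc M j) (n - j))
    (fun γ a β b => compLinKer ℓ Lc (n - j) (b, β) (a, γ))
    (fun m γ a β b => rowsLeg_translate Lc (towerTorus Lc M j) (fun i => lev (i + j)) (n - j) ℓ (brick_rebase Lc n lev ℓ hℓ j (n - j) (by omega)) m γ a β b)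
    S (fun γ a β b h => hS γ a β b h)
    (fun x y (a b : Fin (d + 1)) => w j * ∑ ā : ↥(pbox (towerTorus Lc M j)) × Fin (d + 1),
        hb j ā * SLam N (cf j) 𝒽 ā.2 (ā.1 : Site (d + 1)) x y (Sum.inl a) (Sum.inl b))
    (storey_display Lc N n M ℓ 𝒽 cf w hb h𝒦 j (n - j) (by omega)) (summable_lamCore_diag Lc N M 𝒽 cf w hb hLS hCs hδ j) x y a b
  rwa [towerTorus_towerTorus, show j + (n - j) = n by omega] at h

/-- [folklore] **THE STOREY KERNEL's SECOND-ARGUMENT LETTER ON THE FINEST TORUS**, every storey `j ≤ n` (`summable_dper_sandwich_right_of_tsum`). -/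
theorem summable_storey_right (j : ℕ) (hj : j ≤ n) (x y : Site (d + 1)) (a b : Fin (d + 1)) :
    Summable fun m : Site (d + 1) => dper (towerTorus Lc M n) (𝒦 j) x (translate (towerTorus Lc M n) y m) a b := by
  obtain ⟨S, hS⟩ := exists_rowsLeg_window Lc (n - j) ℓ
  have h := summable_dper_sandwich_right_of_tsum (towerTorus Lc M j) (towerTorus Lc (towerTorus Lc M j) (n - j))
    (fun γ a β b => compLinKer ℓ Lc (n - j) (b, β) (a, γ))
    (fun m γ a β b => rowsLeg_translate Lc (towerTorus Lc M j) (fun i => lev (i + j)) (n - j) ℓ (brick_rebase Lc n lev ℓ hℓ j (n - j) (by omega)) m γ a β b)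
    S (fun γ a β b h => hS γ a β b h)
    (fun x y (a b : Fin (d + 1)) => w j * ∑ ā : ↥(pbox (towerTorus Lc M j)) × Fin (d + 1),
        hb j ā * SLam N (cf j) 𝒽 ā.2 (ā.1 : Site (d + 1)) x y (Sum.inl a) (Sum.inl b))
    (storey_display Lc N n M ℓ 𝒽 cf w hb h𝒦 j (n - j) (by omega)) (summable_lamCore_diag Lc N M 𝒽 cf w hb hLS hCs hδ j)
    (summable_lamCore_right Lc N M 𝒽 cf w hb hLS hCs hδ j) x y a b
  rwa [towerTorus_towerTorus, show j + (n - j) = n by omega] at h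

/-- [folklore] the storey sum's diagonal letter (finite sum of the storeys' letters). -/
theorem summable_storeySum_diag (x y : Site (d + 1)) (a b : Fin (d + 1)) :
    Summable fun m₀ : Site (d + 1) => (∑ j ∈ Finset.range (n + 1), 𝒦 j) (translate (towerTorus Lc M n) x m₀) (translate (towerTorus Lc M n) y m₀) a b := by
  simp only [Finset.sum_apply]
  exact summable_sum fun j hj => summable_storey_diag Lc N n M lev ℓ 𝒽 cf w hb hLS hCs hδ hℓ h𝒦 j (Nat.lt_succ_iff.mp (Finset.mem_range.mp hj)) x y a b

/-- [folklore] the storey sum's second-argument letter. -/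
theorem summable_storeySum_right (x y : Site (d + 1)) (a b : Fin (d + 1)) :
    Summable fun m : Site (d + 1) => dper (towerTorus Lc M n) (∑ j ∈ Finset.range (n + 1), 𝒦 j) x (translate (towerTorus Lc M n) y m) a b := by
  have hd : ∀ x' y' : Site (d + 1), dper (towerTorus Lc M n) (∑ j ∈ Finset.range (n + 1), 𝒦 j) x' y' a b
      = ∑ j ∈ Finset.range (n + 1), dper (towerTorus Lc M n) (𝒦 j) x' y' a b := fun x' y' => by
    simp only [dper_apply, Finset.sum_apply]
    exact Summable.tsum_finsetSum fun j hj =>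
      summable_storey_diag Lc N n M lev ℓ 𝒽 cf w hb hLS hCs hδ hℓ h𝒦 j (Nat.lt_succ_iff.mp (Finset.mem_range.mp hj)) x' y' a b
  simp_rw [hd]
  exact summable_sum fun j hj => summable_storey_right Lc N n M lev ℓ 𝒽 cf w hb hLS hCs hδ hℓ h𝒦 j (Nat.lt_succ_iff.mp (Finset.mem_range.mp hj)) x y a b

/-! ## §6 `H₁f v` is one periodised lattice kernel -/

variable {𝒱 : MKer (d + 1) (Fin (d + 1))} (c : ℝ)
  (h𝒱 : ∀ (x y : Site (d + 1)) (a b : Fin (d + 1)), 𝒱 x y a b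
    = (-2 * c) * (∑ b₀ : ↥(pbox (towerTorus Lc M n)) × Fin (d + 1), hb n b₀ * wilsonA d b₀.2 (b₀.1 : Site (d + 1)) x y (Sum.inl a) (Sum.inl b))
      + ∑ j ∈ Finset.range (n + 1), 𝒦 j x y a b)
include h𝒱

/-- [folklore] **THE DIAGONAL LETTER OF `𝒱`** on the finest torus. -/
theorem summable_H1fKernel_diag (x y : Site (d + 1)) (a b : Fin (d + 1)) :
    Summable fun m₀ : Site (d + 1) => 𝒱 (translate (towerTorus Lc M n) x m₀) (translate (towerTorus Lc M n) y m₀) a b :=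
  summable_diag_of_eq_add (towerTorus Lc M n) (H1fKernel_eq Lc n M hb c h𝒱) (summable_wCore_diag Lc n M hb c)
    (summable_storeySum_diag Lc N n M lev ℓ 𝒽 cf w hb hLS hCs hδ hℓ h𝒦) x y a b

/-- [folklore] **THE SECOND-ARGUMENT LETTER OF `𝒱`** on the finest torus. -/
theorem summable_H1fKernel_right (x y : Site (d + 1)) (a b : Fin (d + 1)) :
    Summable fun m : Site (d + 1) => dper (towerTorus Lc M n) 𝒱 x (translate (towerTorus Lc M n) y m) a b :=
  summable_right_of_eq_add (towerTorus Lc M n) (H1fKernel_eq Lc n M hb c h𝒱) (summable_wCore_diag Lc n M hb c)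
    (summable_storeySum_diag Lc N n M lev ℓ 𝒽 cf w hb hLS hCs hδ hℓ h𝒦) (summable_wCore_right Lc n M hb c)
    (summable_storeySum_right Lc N n M lev ℓ 𝒽 cf w hb hLS hCs hδ hℓ h𝒦) x y a b

/-- [folklore] **`H1f_eq_perF_dper` — THE END WRAPPER's PINNED FIRST-ORDER H-SIDE JET IS ONE PERIODISED LATTICE KERNEL** (SPEC-48 §E (E3)).  Data: `2 ≤ Lc`;
ONE brick list `ℓ` displayed below the depth (`hℓ`); the Λ-brick family `𝒽`, coefficients `cf k`, weights `w k`, storey directions `hb k` (the wrapper's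
`hb n B k v`), the scale `c` (the wrapper's `c n`); the Λ-bricks bi-localised at their bond (`hLS`, an2's `LocStencil`); the storey kernels `𝒦 j`, `j ≤ n`,
DISPLAYED window-free (`h𝒦`, as in `TorusCompanionLamPacked`; `j = n` is the top storey, §3); the kernel `𝒱` DISPLAYED (`h𝒱`): W-core + `Σ_{j ≤ n} 𝒦 j`.
Conclusion: the `hH₁f`-shaped matrix `(−2c) • Σ_b hb n b • (perF T (dper T (wilsonA d b)))|ff + w n • Σ_ā hb n ā • (perF T (dper T (SLam N (cf n) 𝒽 ā)))|ff
+ compSumSym Lc (onTowerFamily Lc M F) M lev rs n` EQUALS `perF T (dper T 𝒱)`, `T := towerTorus Lc M n`. -/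
theorem H1f_eq_perF_dper (hLc : 2 ≤ Lc) (rs : ℕ → (Fin (d + 1) → ℕ)) :
    (-2 * c) • ∑ b₀ : ↥(pbox (towerTorus Lc M n)) × Fin (d + 1), hb n b₀ •
        (perF (towerTorus Lc M n) (dper (towerTorus Lc M n) (wilsonA d b₀.2 (b₀.1 : Site (d + 1))))).submatrix
          (fun p : ↥(pbox (towerTorus Lc M n)) × Fin (d + 1) => ((p.1, Sum.inl p.2) : Idx (towerTorus Lc M n) (Fib d)))
          (fun p : ↥(pbox (towerTorus Lc M n)) × Fin (d + 1) => ((p.1, Sum.inl p.2) : Idx (towerTorus Lc M n) (Fib d)))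
      + w n • ∑ ā : ↥(pbox (towerTorus Lc M n)) × Fin (d + 1), hb n ā •
        (perF (towerTorus Lc M n) (dper (towerTorus Lc M n) (SLam N (cf n) 𝒽 ā.2 (ā.1 : Site (d + 1))))).submatrix
          (fun p : ↥(pbox (towerTorus Lc M n)) × Fin (d + 1) => ((p.1, Sum.inl p.2) : Idx (towerTorus Lc M n) (Fib d)))
          (fun p : ↥(pbox (towerTorus Lc M n)) × Fin (d + 1) => ((p.1, Sum.inl p.2) : Idx (towerTorus Lc M n) (Fib d)))
      + compSumSym Lc (onTowerFamily Lc M (fun k => w k • ∑ ā : ↥(pbox (towerTorus Lc M k)) × Fin (d + 1), hb k ā •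
        (perF (towerTorus Lc M k) (dper (towerTorus Lc M k) (SLam N (cf k) 𝒽 ā.2 (ā.1 : Site (d + 1))))).submatrix
          (fun p : ↥(pbox (towerTorus Lc M k)) × Fin (d + 1) => ((p.1, Sum.inl p.2) : Idx (towerTorus Lc M k) (Fib d)))
          (fun p : ↥(pbox (towerTorus Lc M k)) × Fin (d + 1) => ((p.1, Sum.inl p.2) : Idx (towerTorus Lc M k) (Fib d))))) M lev rs n
      = perF (towerTorus Lc M n) (dper (towerTorus Lc M n) 𝒱) := by
  -- the three summands, periodised: W-core (§4), top storey = co-depth 0 (§3), the storeys below (g36's `compSumSym_lam_eq_perF_dper`)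
  have htop : w n • ∑ ā : ↥(pbox (towerTorus Lc M n)) × Fin (d + 1), hb n ā •
      (perF (towerTorus Lc M n) (dper (towerTorus Lc M n) (SLam N (cf n) 𝒽 ā.2 (ā.1 : Site (d + 1))))).submatrix
        (fun p : ↥(pbox (towerTorus Lc M n)) × Fin (d + 1) => ((p.1, Sum.inl p.2) : Idx (towerTorus Lc M n) (Fib d)))
        (fun p : ↥(pbox (towerTorus Lc M n)) × Fin (d + 1) => ((p.1, Sum.inl p.2) : Idx (towerTorus Lc M n) (Fib d)))
      = perF (towerTorus Lc M n) (dper (towerTorus Lc M n) (𝒦 n)) := by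
    rw [storey_top_eq_core Lc N n M ℓ 𝒽 cf w hb h𝒦]
    exact (perF_dper_core_of_biLoc (towerTorus Lc M n) (fun ā : ↥(pbox (towerTorus Lc M n)) × Fin (d + 1) => SLam N (cf n) 𝒽 ā.2 (ā.1 : Site (d + 1)))
      (p := fun ā => (ā.1 : Site (d + 1))) (q := fun ā => (ā.1 : Site (d + 1))) (C := fun _ => Cs n) (δ := δ) (w n) (hb n) (fun ā => hLS n ā.2 (ā.1 : Site (d + 1))) (fun _ => hCs n) hδ).symm
  -- the storey sum split at the top: `perF T (dper T (Σ_{j ≤ n} 𝒦 j)) = perF T (dper T (Σ_{j < n} 𝒦 j)) + perF T (dper T (𝒦 n))`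
  have hsum : perF (towerTorus Lc M n) (dper (towerTorus Lc M n) (∑ j ∈ Finset.range (n + 1), 𝒦 j))
      = perF (towerTorus Lc M n) (dper (towerTorus Lc M n) (∑ j ∈ Finset.range n, 𝒦 j)) + perF (towerTorus Lc M n) (dper (towerTorus Lc M n) (𝒦 n)) := by
    rw [perF_dper_finset_sum (towerTorus Lc M n) (Finset.range (n + 1)) 𝒦
        (fun j hj => summable_storey_diag Lc N n M lev ℓ 𝒽 cf w hb hLS hCs hδ hℓ h𝒦 j (Nat.lt_succ_iff.mp (Finset.mem_range.mp hj)))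
        (fun j hj => summable_storey_right Lc N n M lev ℓ 𝒽 cf w hb hLS hCs hδ hℓ h𝒦 j (Nat.lt_succ_iff.mp (Finset.mem_range.mp hj))),
      perF_dper_finset_sum (towerTorus Lc M n) (Finset.range n) 𝒦
        (fun j hj => summable_storey_diag Lc N n M lev ℓ 𝒽 cf w hb hLS hCs hδ hℓ h𝒦 j (Finset.mem_range.mp hj).le)
        (fun j hj => summable_storey_right Lc N n M lev ℓ 𝒽 cf w hb hLS hCs hδ hℓ h𝒦 j (Finset.mem_range.mp hj).le),
      Finset.sum_range_succ]
  rw [perF_dper_wCore Lc n M hb c, htop, compSumSym_lam_eq_perF_dper Lc hLc N n M lev rs ℓ hℓ 𝒽 cf w hb hLS hCs hδ h𝒦,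
    perF_dper_of_eq_add (towerTorus Lc M n) (H1fKernel_eq Lc n M hb c h𝒱) (summable_wCore_diag Lc n M hb c)
      (summable_storeySum_diag Lc N n M lev ℓ 𝒽 cf w hb hLS hCs hδ hℓ h𝒦)
      (summable_wCore_right Lc n M hb c) (summable_storeySum_right Lc N n M lev ℓ 𝒽 cf w hb hLS hCs hδ hℓ h𝒦),
    hsum, add_assoc, add_comm (perF (towerTorus Lc M n) (dper (towerTorus Lc M n) (𝒦 n)))]

end Storeys

end Summit.QuantumFields.BalabanUV.Beta.FP.TorusHSideJetPeriodic

end
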